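import Literature.NumberTheory.Automorphic.Liu2021.LemD1AsPrintedIndexedNonVacuityTameTwist
import Literature.NumberTheory.Automorphic.Liu2021.LemD1AsPrintedIndexedNonVacuityInertCofinite
import HarnessLib

/-!
# [Liu2021, App. D §D.1 Step 2 ∕ Lemma D.1 (3)] — the INERT SIGN CHARACTER: at every place with an inert witness of ANY quadratic
# extension `E/F` of number fields, `x ↦ (−1)^{ord_w x_w}` IS a Step-2 datum; the printed Step-2 index set is non-empty there
# WITHOUT CM input, has exactly one unramified element, and (off `2`) at least two elements

Reproduction ∕ bookkeeping (Literature, THEOREMS ONLY: no definition, no record, no named fact, no `sorry`; nothing is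
asserted about Liu's oscillator representations or about the tree's constructed local Weil carriers).

Sequel of `LemD1AsPrintedIndexedNonVacuityInertRigidity.lean` (whose «What this does NOT give» names «the existence of an unramified
Step-2 character at a GENERAL (non-CM) `E/F` (for the CM rows it is `μ_v` itself at almost every place)»), of
`…NonsplitPlace.lean` («a Step-2 character of the place model at a non-split place of a GENERAL (non-CM) quadratic `E/F`» not given; norms
from `E_vˣ` have index EXACTLY `2` in `F_vˣ`, `index_norms_eq_two_of_nonsplit`, from the tree's local norm index theorem
`QuadraticForms.index_quadraticNormSubgroup_adicCompletion_eq_two` [Omeara1963, §63B Cor. 63:13a]), of `…InertCofinite.lean` (inert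
witnesses at all but finitely many places) and of `…TameTwist.lean` (a second Step-2 datum next to any given one, off `2`).
Setting: the tree's place model of a quadratic extension `E/F` of number fields at a finite place `v` (`F_v`, `E_v = Π_{w∣v} E_w`,
`c ⊗ 1 = conjLocal`, `c δ = −δ ≠ 0`), a place `w ∣ v` FIXED by `c` (non-split) and an INERT WITNESS `π ∈ F_vˣ`, `v_w(ι_w π) = exp(−1)`
(⟺ `e(w|v) = 1`, `…InertCofinite`).

* §1 **`isNorm_iff_even_log`**: `a ∈ F_vˣ` is a norm `x · (c ⊗ 1) x` from `E_vˣ` iff `ord_w(ι_w a)` is EVEN.  (→) norms have even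
  valuation (`…InertRigidity.valued_mul_conjLocal_apply`); (←) the norm group `N` has index `2` and `π ∉ N` (odd valuation), so for
  `a ∉ N` the product `a · π ∈ N` (Mathlib `Subgroup.mul_mem_iff_of_index_two`) has even valuation and `ord_w(ι_w a)` is odd.  This is the
  classical «`N(E_wˣ) = (π²) × U_K` for the unramified quadratic extension `E_w/F_v`» [NeukirchANT1999, Ch. V §1 Cor. (1.2):
  `N_{L|K} U_L = U_K` for `L|K` unramified] obtained here from the INDEX alone.
* §2 **`exists_stepTwo_sign`**: the character `μ₀(x) = (−1)^{ord_w x_w}` of `E_vˣ` is a Step-2 datum in the rows' displayed binder shape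
  (unitary; continuous — open kernel, the valuation is locally constant; the printed clause «`μ₀(ι_v a) = 1 ↔ a ∈ Nm E_vˣ`» is §1), trivial
  on the units of `w`-valuation `1`, `μ₀(ι_v π) = −1`.  Hence **`exists_muSet_of_inertWitness`** (the printed Step-2 index set
  `LemD1.MuSet (LemD1OfPlace.standingData …)` is NON-EMPTY at every place with an inert witness of ANY quadratic `E/F` — the tree had this
  only for CM rows, `…NonsplitPlace.nonempty_muSet_of_isCMField`), **`existsUnique_muSet_unramified_of_inertWitness`** (with
  `…InertRigidity.muSet_eq_of_unramified`: EXACTLY ONE unramified element), **`exists_muSet_ne_of_inertWitness`** (off `2`: a SECOND,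
  ramified element — the tame twist of `…TameTwist`), **`not_forall_lemD1_3_of_item1_of_inertWitness`** (rank `N ≥ 3`: at an inert place
  `∤ 2` of any quadratic `E/F`, (3) AS PRINTED is NOT a consequence of (1) on two-member collections — NO input datum needed), and the
  cofinite forms `eventually_forall_nonempty_muSet` ∕ `eventually_forall_exists_muSet_ne` (at all but finitely many `v`, for every
  `c`-fixed `w ∣ v`: non-empty ∕ two elements, via `…InertCofinite.eventually_forall_valued_toPlace_uniformizer`).

What this does NOT give: the RAMIFIED non-split places (no unramified Step-2 datum there, `…RamifiedPlace` §4; a Step-2 datum at a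
ramified place of a general `E/F` needs an extension of the local quadratic character from `𝒪_vˣ` to `𝒪_wˣ`, not constructed); the
dyadic inert places for the two-element statement; carriers; Lem. D.1 itself.  HC_CM is NOT proved.

Cell pub-hodgecm2 (COR-CM), audit class of the END rows `hD1''` ∕ `hD3`; seat prover-pub-hodgecm2-b10.

References: [Liu2021] Y. Liu, *Fourier–Jacobi cycles and arithmetic relative trace formula*, Camb. J. Math. 9 (2021) =
arXiv:2102.11518, App. D §D.1 Step 2 (`FJcycle.tex` l. 5219), Lemma D.1 (1) (l. 5229), (3) (l. 5233); [NeukirchANT1999] J. Neukirch,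
*Algebraic Number Theory* (1999), Ch. V §1 Cor. (1.2) (`N_{L|K} U_L = U_K` for unramified `L|K`), Ch. II §5 Prop. (5.3), Ch. III §2
Thm. (2.6) (finitely many ramified primes); [CasselsFrohlichANT1967] Ch. II §10 (completions of a quadratic extension); [Omeara1963]
O. T. O'Meara, *Introduction to Quadratic Forms* (1963), §63B Cor. 63:13a (the local norm index `2`).
-/

noncomputable section

open scoped Matrix MatrixGroups
open NumberField IsDedekindDomain
open Literature.RepresentationTheory
open Literature.NumberTheory.QuadraticForms (quadraticNormSubgroup)
open Literature.NumberTheory.GaloisRepresentations (HeckeCharacter)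

namespace Literature.NumberTheory.Automorphic.Liu2021.LemD1IndexedNonVacuityInertSign

open UnitaryGroup

section General

variable {F : Type} (E : Type) [Field F] [NumberField F] [Field E] [NumberField E] [Algebra F E]
  [Algebra.IsQuadraticExtension F E] (v : HeightOneSpectrum (𝓞 F)) (c : E ≃ₐ[F] E)
  {δ : E} (hcδ : c δ = -δ) (hδ : δ ≠ 0)

include hcδ hδ in
/-- `δ² ∈ F` for `c δ = −δ ≠ 0` in a quadratic `E/F` (copy of the private lemma of `LemD1IndexedNonVacuityNonsplitPlace`). [folklore] -/
private theorem exists_delta_mul_self_eq_algebraMap : ∃ d : F, δ * δ = algebraMap F E d := by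
  obtain ⟨x, y, hxy⟩ := exists_eq_add_mul_of_isQuadraticExtension (F := F) (E := E)
    (not_mem_range_algebraMap_of_apply_eq_neg E c hcδ hδ) (δ * δ)
  have hc2 : c (δ * δ) = δ * δ := by rw [map_mul, hcδ, neg_mul_neg]
  have hy : algebraMap F E y * δ = 0 := by
    have h1 : c (δ * δ) = algebraMap F E x - algebraMap F E y * δ := by
      rw [hxy, map_add, map_mul, AlgEquiv.commutes, AlgEquiv.commutes, hcδ, mul_neg, sub_eq_add_neg]
    rw [hc2, hxy] at h1
    have h2 : (2 : E) * (algebraMap F E y * δ) = 0 := by linear_combination h1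
    exact (mul_eq_zero.1 h2).resolve_left two_ne_zero
  exact ⟨x, by rw [hxy, hy, add_zero]⟩

omit [Algebra.IsQuadraticExtension F E] in
/-- `ord_w(ι_w(a · π^m)) = ord_w(ι_w a) − m` for an inert witness `π` (`v_w(ι_w π) = exp(−1)`). [cite: CasselsFrohlichANT1967, Ch. II §10] -/
private theorem log_valued_toPlace_mul_zpow (w : PlacesOver E v) (π : (v.adicCompletion F)ˣ)
    (hπ : Valued.v (toPlace v w (π : v.adicCompletion F)) = WithZero.exp (-1 : ℤ)) (a : (v.adicCompletion F)ˣ) (m : ℤ) :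
    WithZero.log (Valued.v (toPlace v w ((a * π ^ m : (v.adicCompletion F)ˣ) : v.adicCompletion F))) =
      WithZero.log (Valued.v (toPlace v w (a : v.adicCompletion F))) - m := by
  have ha0 : Valued.v (toPlace v w (a : v.adicCompletion F)) ≠ 0 :=
    (Valuation.ne_zero_iff _).2 ((map_ne_zero _).2 a.ne_zero)
  rw [Units.val_mul, Units.val_zpow_eq_zpow_val, map_mul, map_zpow₀, map_mul, map_zpow₀, hπ, ← WithZero.exp_zsmul,
    WithZero.log_mul ha0 WithZero.exp_ne_zero, WithZero.log_exp, smul_eq_mul, mul_neg, mul_one, sub_eq_add_neg]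

/-! ## §1 The norm group of the place model at a place with an inert witness: `a ∈ Nm E_vˣ ↔ ord_w(ι_w a)` even -/

include hcδ hδ in
/-- **at a non-split place with an inert witness, `a ∈ F_vˣ` is a norm `x · (c ⊗ 1) x` from `E_vˣ` iff `ord_w(ι_w a)` is EVEN**
(→: norms have even `w`-valuation; ←: the norm group has index `2` in `F_vˣ` and misses `π`, so a non-norm `a` has `a · π` a norm, of even
valuation, and `ord_w(ι_w a)` odd) — the norm group of the unramified quadratic extension `E_w/F_v`.
[cite: NeukirchANT1999, Ch. V §1 Cor. (1.2)] [cite: Omeara1963, §63B Cor. 63:13a] [cite: Liu2021, App. D §D.1 Step 2 (l. 5219)] -/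
theorem isNorm_iff_even_log (w : PlacesOver E v) (hw : c • w.1 = w.1) (π : (v.adicCompletion F)ˣ)
    (hπ : Valued.v (toPlace v w (π : v.adicCompletion F)) = WithZero.exp (-1 : ℤ)) (a : (v.adicCompletion F)ˣ) :
    (∃ x : (LocalRing E v)ˣ, (x : LocalRing E v) * conjLocal E c v x = algebraMap (v.adicCompletion F) (LocalRing E v) a) ↔
      Even (WithZero.log (Valued.v (toPlace v w (a : v.adicCompletion F)))) := by
  -- (→): norms have even valuation
  have himp : ∀ b : (v.adicCompletion F)ˣ,
      (∃ x : (LocalRing E v)ˣ, (x : LocalRing E v) * conjLocal E c v x = algebraMap (v.adicCompletion F) (LocalRing E v) b) →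
        Even (WithZero.log (Valued.v (toPlace v w (b : v.adicCompletion F)))) := by
    rintro b ⟨x, hx⟩
    have h : Valued.v (((x : LocalRing E v) * conjLocal E c v x) w) =
        Valued.v ((algebraMap (v.adicCompletion F) (LocalRing E v) (b : v.adicCompletion F)) w) := by rw [hx]
    rw [LemD1IndexedNonVacuityInertRigidity.valued_mul_conjLocal_apply E v c hcδ hδ w hw, algebraMap_localRing_eq,
      toLocalRing_apply] at h
    have hx0 : Valued.v ((x : LocalRing E v) w) ≠ 0 :=
      (Valuation.ne_zero_iff _).2
        (Units.ne_zero (Units.map (Pi.evalRingHom (fun w' : PlacesOver E v => w'.1.adicCompletion E) w).toMonoidHom x))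
    rw [← h, sq, WithZero.log_mul hx0 hx0]
    exact ⟨_, rfl⟩
  refine ⟨himp a, fun heven => ?_⟩
  -- (←): the norm group has index 2 and does not contain `π`
  obtain ⟨d, hd⟩ := exists_delta_mul_self_eq_algebraMap E c hcδ hδ
  have hidx := LemD1IndexedNonVacuityNonsplitPlace.index_norms_eq_two_of_nonsplit E v c hcδ hδ w hw hd
  have hπN : π ∉ quadraticNormSubgroup (v.adicCompletion F) (d : v.adicCompletion F) := fun h =>
    LemD1IndexedNonVacuityInertRigidity.not_isNorm_of_valued_eq E v c hcδ hδ w hw π hπ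
      ((LemD1IndexedNonVacuityNonsplitPlace.isNorm_iff_mem_quadraticNormSubgroup E v c hcδ hδ hd π).2 h)
  by_contra hnot
  have haN : a ∉ quadraticNormSubgroup (v.adicCompletion F) (d : v.adicCompletion F) := fun h =>
    hnot ((LemD1IndexedNonVacuityNonsplitPlace.isNorm_iff_mem_quadraticNormSubgroup E v c hcδ hδ hd a).2 h)
  have haπ : a * π ∈ quadraticNormSubgroup (v.adicCompletion F) (d : v.adicCompletion F) :=
    (Subgroup.mul_mem_iff_of_index_two hidx).2 (iff_of_false haN hπN)
  have h2 := himp (a * π) ((LemD1IndexedNonVacuityNonsplitPlace.isNorm_iff_mem_quadraticNormSubgroup E v c hcδ hδ hd _).2 haπ)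
  have h3 := log_valued_toPlace_mul_zpow E v w π hπ a 1
  rw [zpow_one] at h3
  rw [h3] at h2
  obtain ⟨k, hk⟩ := heven
  obtain ⟨l, hl⟩ := h2
  omega

/-! ## §2 The unramified sign character `x ↦ (−1)^{ord_w x_w}` is a Step-2 datum; consequences for `MuSet` -/

/-- A homomorphism with open kernel is locally constant (copy of the tree's private lemma). [folklore] -/
private theorem isLocallyConstant_of_isOpen_ker {Γ G : Type*} [Group Γ] [TopologicalSpace Γ]
    [ContinuousMul Γ] [Group G] (r : Γ →* G) (h : IsOpen (r.ker : Set Γ)) :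
    IsLocallyConstant r := by
  refine (IsLocallyConstant.iff_exists_open r).2 fun σ => ⟨{τ | σ⁻¹ * τ ∈ r.ker}, ?_, ?_, ?_⟩
  · exact h.preimage (continuous_const_mul σ⁻¹)
  · show σ⁻¹ * σ ∈ r.ker
    rw [inv_mul_cancel]; exact r.ker.one_mem
  · intro τ hτ
    have hτ' : r (σ⁻¹ * τ) = 1 := hτ
    rw [map_mul, map_inv, inv_mul_eq_one] at hτ'
    exact hτ'.symm

/-- `(−1)^n = 1` in `ℂˣ` iff `n` is even. [folklore] -/
private theorem neg_one_zpow_eq_one_iff_even (n : ℤ) : (-1 : ℂˣ) ^ n = 1 ↔ Even n := by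
  refine ⟨fun h => ?_, fun h => h.neg_one_zpow⟩
  rcases Int.even_or_odd n with hn | hn
  · exact hn
  · rw [hn.neg_one_zpow] at h
    have := Units.ext_iff.1 h
    rw [Units.val_neg, Units.val_one] at this
    norm_num at this

omit [NumberField F] [Algebra.IsQuadraticExtension F E] in
/-- the components of a unit of `E_v = Π_{w∣v} E_w` are non-zero, so have non-zero valuation. [folklore] -/
private theorem valued_apply_ne_zero (w : PlacesOver E v) (x : (LocalRing E v)ˣ) : Valued.v ((x : LocalRing E v) w) ≠ 0 :=
  (Valuation.ne_zero_iff _).2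
    (Units.ne_zero (Units.map (Pi.evalRingHom (fun w' : PlacesOver E v => w'.1.adicCompletion E) w).toMonoidHom x))

include hcδ hδ in
/-- **THE UNRAMIFIED SIGN CHARACTER IS A STEP-2 DATUM at every place with an inert witness, for ANY quadratic `E/F`**: at a place
`w ∣ v` fixed by `c` with `π ∈ F_vˣ` of `w`-valuation `exp(−1)`, the character `μ₀(x) = (−1)^{ord_w x_w}` of `E_vˣ` is unitary,
continuous (open kernel: the valuation is locally constant), trivial on the units of `w`-valuation `1`, takes the value `−1` at `ι_v π`, and
satisfies the printed clause «`μ₀(ι_v a) = 1 ↔ a ∈ Nm E_vˣ`» («`μ|_{F^×}` is the unique character whose kernel is exactly `Nm_{E/F} E^×`»,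
by §1).  So Step 2 of [Liu2021, App. D §D.1] CAN be performed in the place model at such a place with no global input.
[cite: Liu2021, App. D §D.1 Step 2 (l. 5219)] [cite: NeukirchANT1999, Ch. V §1 Cor. (1.2)] -/
theorem exists_stepTwo_sign (w : PlacesOver E v) (hw : c • w.1 = w.1) (π : (v.adicCompletion F)ˣ)
    (hπ : Valued.v (toPlace v w (π : v.adicCompletion F)) = WithZero.exp (-1 : ℤ)) :
    ∃ (μ : (LocalRing E v)ˣ →* ℂˣ) (_ : ∀ x, ‖((μ x : ℂˣ) : ℂ)‖ = 1) (_ : Continuous fun x => ((μ x : ℂˣ) : ℂ))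
      (_ : ∀ a : (v.adicCompletion F)ˣ,
        μ (Units.map (algebraMap (v.adicCompletion F) (LocalRing E v)).toMonoidHom a) = 1 ↔
          ∃ x : (LocalRing E v)ˣ, (x : LocalRing E v) * conjLocal E c v x =
            algebraMap (v.adicCompletion F) (LocalRing E v) a),
      (∀ x : (LocalRing E v)ˣ, μ x = (-1 : ℂˣ) ^ WithZero.log (Valued.v ((x : LocalRing E v) w))) ∧
      (∀ u : (LocalRing E v)ˣ, Valued.v ((u : LocalRing E v) w) = 1 → μ u = 1) ∧
      μ (Units.map (algebraMap (v.adicCompletion F) (LocalRing E v)).toMonoidHom π) = -1 := by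
  let μ : (LocalRing E v)ˣ →* ℂˣ :=
    { toFun := fun x => (-1 : ℂˣ) ^ WithZero.log (Valued.v ((x : LocalRing E v) w))
      map_one' := by rw [Units.val_one, Pi.one_apply, map_one, WithZero.log_one, zpow_zero]
      map_mul' := fun x y => by
        rw [Units.val_mul, Pi.mul_apply, map_mul, WithZero.log_mul (valued_apply_ne_zero E v w x) (valued_apply_ne_zero E v w y),
          zpow_add] }
  have hμ : ∀ x : (LocalRing E v)ˣ, μ x = (-1 : ℂˣ) ^ WithZero.log (Valued.v ((x : LocalRing E v) w)) := fun x => rfl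
  have hunit : ∀ u : (LocalRing E v)ˣ, Valued.v ((u : LocalRing E v) w) = 1 → μ u = 1 := fun u hu => by
    rw [hμ, hu, WithZero.log_one, zpow_zero]
  have hιw : ∀ a : (v.adicCompletion F)ˣ,
      ((Units.map (algebraMap (v.adicCompletion F) (LocalRing E v)).toMonoidHom a : (LocalRing E v)ˣ) : LocalRing E v) w =
        toPlace v w (a : v.adicCompletion F) := fun a => by
    rw [Units.coe_map, RingHom.toMonoidHom_eq_coe, MonoidHom.coe_coe, algebraMap_localRing_eq, toLocalRing_apply]
  refine ⟨μ, fun x => ?_, ?_, fun a => ?_, hμ, hunit, ?_⟩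
  · rw [hμ, Units.val_zpow_eq_zpow_val, norm_zpow, Units.val_neg, Units.val_one, norm_neg, norm_one, one_zpow]
  · -- open kernel ⇒ continuous
    have hopen : IsOpen (μ.ker : Set (LocalRing E v)ˣ) := by
      refine Subgroup.isOpen_of_mem_nhds _ (g := 1) ?_
      have h1 : {y : w.1.adicCompletion E | Valued.v y = Valued.v (((1 : (LocalRing E v)ˣ) : LocalRing E v) w)} ∈
          nhds (((1 : (LocalRing E v)ˣ) : LocalRing E v) w) := Valued.locally_const (valued_apply_ne_zero E v w 1)
      have h2 := ((continuous_apply w).comp Units.continuous_val).continuousAt.preimage_mem_nhds h1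
      refine Filter.mem_of_superset h2 fun x hx => ?_
      simp only [Set.mem_preimage, Function.comp_apply, Set.mem_setOf_eq, Units.val_one, Pi.one_apply, map_one] at hx
      exact hunit x hx
    exact Units.continuous_val.comp (isLocallyConstant_of_isOpen_ker μ hopen).continuous
  · rw [hμ, hιw, neg_one_zpow_eq_one_iff_even]
    exact (isNorm_iff_even_log E v c hcδ hδ w hw π hπ a).symm
  · rw [hμ, hιw, hπ, WithZero.log_exp, zpow_neg, zpow_one, inv_neg_one]

variable (N : ℕ) (J : Matrix (Fin N) (Fin N) E) (hN : 2 ≤ N) (hJh : (J.map c)ᵀ = J) (hJdet : J.det ≠ 0)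

include hcδ in
/-- **`MuSet` is NON-EMPTY at every place with an inert witness, for ANY quadratic `E/F`** (non-split `w ∣ v`, `v_w(ι_w π) = exp(−1)`):
the printed Step-2 index set `LemD1.MuSet (LemD1OfPlace.standingData …)` of the place model contains the unramified sign character
`x ↦ (−1)^{ord_w x_w}` (packaged by `LemD1OfPlace.muOf`).  The tree had non-emptiness at non-split places only for the CM rows
(`LemD1IndexedNonVacuityNonsplitPlace.nonempty_muSet_of_isCMField`). [cite: Liu2021, App. D §D.1 Step 2 (l. 5219)] -/
theorem exists_muSet_of_inertWitness (w : PlacesOver E v) (hw : c • w.1 = w.1) (π : (v.adicCompletion F)ˣ)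
    (hπ : Valued.v (toPlace v w (π : v.adicCompletion F)) = WithZero.exp (-1 : ℤ)) :
    ∃ μ : LemD1.MuSet (LemD1OfPlace.standingData E v c N J hcδ hδ hN hJh hJdet),
      (∀ x : (LocalRing E v)ˣ, μ.1 x = (-1 : ℂˣ) ^ WithZero.log (Valued.v ((x : LocalRing E v) w))) ∧
      ∀ u : (LocalRing E v)ˣ, Valued.v ((u : LocalRing E v) w) = 1 → μ.1 u = 1 := by
  obtain ⟨μ, hμn, hμc, hμF, hμ, hunit, -⟩ := exists_stepTwo_sign E v c hcδ hδ w hw π hπ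
  exact ⟨LemD1OfPlace.muOf E v c N J hcδ hδ hN hJh hJdet μ hμn hμc hμF, hμ, hunit⟩

include hcδ in
/-- **… and it is THE unramified element**: by the rigidity of `LemD1IndexedNonVacuityInertRigidity` (`muSet_eq_of_unramified`) the printed
Step-2 index set at such a place has EXACTLY ONE element trivial on the units of `w`-valuation `1` — existence from §2, uniqueness from the
prequel. [cite: Liu2021, App. D §D.1 Step 2 (l. 5219)] -/
theorem existsUnique_muSet_unramified_of_inertWitness (w : PlacesOver E v) (hw : c • w.1 = w.1) (π : (v.adicCompletion F)ˣ)
    (hπ : Valued.v (toPlace v w (π : v.adicCompletion F)) = WithZero.exp (-1 : ℤ)) :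
    ∃! μ : LemD1.MuSet (LemD1OfPlace.standingData E v c N J hcδ hδ hN hJh hJdet),
      ∀ u : (LocalRing E v)ˣ, Valued.v ((u : LocalRing E v) w) = 1 → μ.1 u = 1 := by
  obtain ⟨μ, -, hunit⟩ := exists_muSet_of_inertWitness E v c hcδ hδ N J hN hJh hJdet w hw π hπ
  exact ⟨μ, hunit, fun μ' hμ' =>
    LemD1IndexedNonVacuityInertRigidity.muSet_eq_of_unramified E v c hcδ hδ N J hN hJh hJdet w hw π hπ μ' μ hμ' hunit⟩

include hcδ in
/-- **TWO elements at an inert place `∤ 2`, for ANY quadratic `E/F`**: the unramified sign character `μ₀` and its tame twist `μ₁`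
(`LemD1IndexedNonVacuityTameTwist.exists_muSet_ne_twist`), `μ₀ ≠ μ₁`, and `μ₁` is RAMIFIED (`≠ 1` at some unit of `w`-valuation `1` —
else it would be the unique unramified element `μ₀`). [cite: Liu2021, App. D §D.1 Step 2 (l. 5219)] [cite: NeukirchANT1999, Ch. II §5 Prop. (5.3)] -/
theorem exists_muSet_ne_of_inertWitness (w : PlacesOver E v) (hw : c • w.1 = w.1) (h2 : (2 : 𝓞 E) ∉ w.1.asIdeal)
    (π : (v.adicCompletion F)ˣ) (hπ : Valued.v (toPlace v w (π : v.adicCompletion F)) = WithZero.exp (-1 : ℤ)) :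
    ∃ μ₀ μ₁ : LemD1.MuSet (LemD1OfPlace.standingData E v c N J hcδ hδ hN hJh hJdet), μ₀ ≠ μ₁ ∧
      (∀ u : (LocalRing E v)ˣ, Valued.v ((u : LocalRing E v) w) = 1 → μ₀.1 u = 1) ∧
      ∃ u : (LocalRing E v)ˣ, Valued.v ((u : LocalRing E v) w) = 1 ∧ μ₁.1 u ≠ 1 := by
  obtain ⟨μ₀, -, hunit⟩ := exists_muSet_of_inertWitness E v c hcδ hδ N J hN hJh hJdet w hw π hπ
  obtain ⟨μ₁, hne, -, -⟩ := LemD1IndexedNonVacuityTameTwist.exists_muSet_ne_twist E v c hcδ hδ N J hN hJh hJdet w h2 μ₀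
  refine ⟨μ₀, μ₁, fun h => hne h.symm, hunit, ?_⟩
  by_contra hall
  push Not at hall  -- hall : ∀ u, v = 1 → μ₁ u = 1
  exact hne (LemD1IndexedNonVacuityInertRigidity.muSet_eq_of_unramified E v c hcδ hδ N J hN hJh hJdet w hw π hπ μ₁ μ₀ hall hunit)

include hcδ in
/-- **the μ-teeth of [Lem. D.1 (3)] AS PRINTED at an inert place `∤ 2` of ANY quadratic `E/F`, with NO input datum** (rank `N ≥ 3`):
the two-member trivial-carrier collection on the sign character and its tame twist satisfies (1) member by member and VIOLATES
`LemD1_3AsPrintedI` (`LemD1IndexedNonVacuityTameTwist.not_forall_lemD1_3_of_item1_twist` fed with §2's element) — (3) AS PRINTED is not a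
consequence of (1) there. [cite: Liu2021, App. D Lemma D.1 (1) and (3) (l. 5229, 5233)] -/
theorem not_forall_lemD1_3_of_item1_of_inertWitness (w : PlacesOver E v) (hw : c • w.1 = w.1)
    (h2 : (2 : 𝓞 E) ∉ w.1.asIdeal) (π : (v.adicCompletion F)ˣ)
    (hπ : Valued.v (toPlace v w (π : v.adicCompletion F)) = WithZero.exp (-1 : ℤ)) (h3 : 3 ≤ N) :
    ¬ ∀ Lf : LemD1IndexedFamily (v.adicCompletion F) (LocalRing E v) N (Fin 2),
        Lf.S = LemD1OfPlace.standingData E v c N J hcδ hδ hN hJh hJdet → Lf.Item1AsPrinted → LemD1_3AsPrintedI Lf := by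
  obtain ⟨μ₀, -, -⟩ := exists_muSet_of_inertWitness E v c hcδ hδ N J hN hJh hJdet w hw π hπ
  exact LemD1IndexedNonVacuityTameTwist.not_forall_lemD1_3_of_item1_twist E v c hcδ hδ N J hN hJh hJdet w h2 h3 ⟨μ₀⟩

include hcδ in
/-- **cofinite form, ANY quadratic `E/F`**: at all but finitely many places `v` of `F`, for every `w ∣ v` fixed by `c` (and every
hermitian `J`) the printed Step-2 index set of the place model is NON-EMPTY (the uniformiser `ϖ_v` of `F_v` is an inert witness at every
`w ∣ v` off the ramification of `E/F`, `LemD1IndexedNonVacuityInertCofinite.eventually_forall_valued_toPlace_uniformizer`).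
[cite: Liu2021, App. D §D.1 Step 2 (l. 5219)] [cite: NeukirchANT1999, Ch. III §2 Thm. (2.6)] -/
theorem eventually_forall_nonempty_muSet :
    ∀ᶠ v : HeightOneSpectrum (𝓞 F) in Filter.cofinite, ∀ w : PlacesOver E v, c • w.1 = w.1 →
      ∀ (J : Matrix (Fin N) (Fin N) E) (hJh : (J.map c)ᵀ = J) (hJdet : J.det ≠ 0),
        Nonempty (LemD1.MuSet (LemD1OfPlace.standingData E v c N J hcδ hδ hN hJh hJdet)) :=
  (LemD1IndexedNonVacuityInertCofinite.eventually_forall_valued_toPlace_uniformizer E).mono fun v hv w hw J hJh hJdet => by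
    obtain ⟨μ, -⟩ := exists_muSet_of_inertWitness E v c hcδ hδ N J hN hJh hJdet w hw (HeckeCharacter.uniformizer F v) (hv w)
    exact ⟨μ⟩

/-- all but finitely many places of `F` are `∤ 2` (Mathlib `Ideal.finite_factors`). [folklore] -/
private theorem finite_setOf_two_mem : {v : HeightOneSpectrum (𝓞 F) | (2 : 𝓞 F) ∈ v.asIdeal}.Finite := by
  have h := Ideal.finite_factors (I := Ideal.span {(2 : 𝓞 F)}) (by
    rw [Ideal.zero_eq_bot, Ne, Ideal.span_singleton_eq_bot]; exact two_ne_zero)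
  refine h.subset fun v hv => ?_
  simp only [Set.mem_setOf_eq] at hv ⊢
  rw [Ideal.dvd_span_singleton]
  exact hv

include hcδ in
/-- **cofinite form with TWO elements, ANY quadratic `E/F`**: at all but finitely many places `v` of `F` (off the ramification of `E/F`
and the prime factors of `2`), for every `w ∣ v` fixed by `c` (and every hermitian `J`) the printed Step-2 index set of the place model has
two distinct elements — one unramified (the sign character), one ramified (its tame twist).
[cite: Liu2021, App. D §D.1 Step 2 (l. 5219)] [cite: NeukirchANT1999, Ch. III §2 Thm. (2.6) and Ch. II §5 Prop. (5.3)] -/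
theorem eventually_forall_exists_muSet_ne :
    ∀ᶠ v : HeightOneSpectrum (𝓞 F) in Filter.cofinite, ∀ w : PlacesOver E v, c • w.1 = w.1 →
      ∀ (J : Matrix (Fin N) (Fin N) E) (hJh : (J.map c)ᵀ = J) (hJdet : J.det ≠ 0),
        ∃ μ₀ μ₁ : LemD1.MuSet (LemD1OfPlace.standingData E v c N J hcδ hδ hN hJh hJdet), μ₀ ≠ μ₁ ∧
          (∀ u : (LocalRing E v)ˣ, Valued.v ((u : LocalRing E v) w) = 1 → μ₀.1 u = 1) ∧
          ∃ u : (LocalRing E v)ˣ, Valued.v ((u : LocalRing E v) w) = 1 ∧ μ₁.1 u ≠ 1 := by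
  filter_upwards [LemD1IndexedNonVacuityInertCofinite.eventually_forall_valued_toPlace_uniformizer E,
    (finite_setOf_two_mem (F := F)).compl_mem_cofinite] with v hv hv2 w hw J hJh hJdet
  exact exists_muSet_ne_of_inertWitness E v c hcδ hδ N J hN hJh hJdet w hw
    (LemD1IndexedNonVacuityTameTwist.two_not_mem_of_placesOver E v w hv2) (HeckeCharacter.uniformizer F v) (hv w)

end General

end Literature.NumberTheory.Automorphic.Liu2021.LemD1IndexedNonVacuityInertSign

end
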